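import Literature.Analysis.FluidPDE.MikadoSelfInteraction
import Literature.Analysis.FunctionSpaces.TorusInverseLaplacianCalculus
import Literature.Analysis.FluidPDE.AntidivergenceDerivLp
import Literature.Analysis.FluidPDE.AntidivergenceHolder
import HarnessLib

/-!
# All-orders sup-norm bounds for `ℛ div` on the flat 3-torus, in the currency `HasLiftDerivBounds`

Analysis/FluidPDE support file (definitions with proved API; no named facts). The De Lellis–Székelyhidi
antidivergence composed with the tensor divergence, `A ↦ ℛ(div A)`, is a Calderón–Zygmund operator of
order `0` (Buckmaster–De Lellis–Székelyhidi–Vicol 2019, §6.1.3 with App. C Prop. C.1; in the tree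
`BDSV.holder_antidivergence_tensorDivergence_le`: `‖ℛ div A‖_{C^{0,α}} ≤ C_α ‖A‖_{C^{0,α}}`). This file upgrades
that `C^{0,α}` bound to the all-orders geometric sup bounds used for series of Mikado blocks:

* `CP25.norm_iteratedFDeriv_succ_le_sum_partialDeriv` — `‖D^{n+1}(lift g)(y)‖ ≤ ∑_l ‖Dⁿ(lift ∂_l g)(y)‖`
  and `CP25.hasLiftDerivBounds_succ_of_partialDeriv` — geometric bounds of order `n+1` from those of the
  partial derivatives at order `n` (constant `×3`);
* `CP25.antidivTensor_tensorDiv_partialDeriv` — `∂_m ℛ(div A) = ℛ(div ∂_m A)` (`ℛ`, `div` have constant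
  coefficients);
* `CP25.czDivConst α n` and **`CP25.hasLiftDerivBounds_antidivTensor_tensorDiv`**:
  `HasLiftDerivBounds (n+1) A C L`, `1 ≤ L` ⟹ `HasLiftDerivBounds n (ℛ div A) (czDivConst α n · C · L^α) L`
  (induction on `n`; the base case is the `C^{0,α}` bound, read in sup norm).

## Mathlib / tree search

Tree: `BDSV.holder_antidivergence_tensorDivergence_le`, `BDSV.holderCZBound_holds`, `Torus.partialDeriv_antidivEntry`,
`Torus.antidivPotential_partialDeriv`-type commutations (`Antidivergence*`), `Torus.partialDeriv_invLaplacian`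
(`TorusInverseLaplacianCalculus`), `CP25.eContDiffHolderNorm_le_of_hasLiftDerivBounds`,
`norm_iteratedFDeriv_lift_le_of_eContDiffHolderNorm_le` (`LerayTensorHolder`), `CP25.antidivTensor`
(`MikadoSelfInteraction`). Mathlib: `ContinuousLinearMap.iteratedFDeriv_comp_left`, `ContinuousMultilinearMap.opNorm_le_bound`,
`PiLp.norm_apply_le`.

## References

* T. Buckmaster, C. De Lellis, L. Székelyhidi Jr., V. Vicol, CPAM 72 (2019), §6.1.3 and App. C Prop. C.1.
  [BuckmasterEtAl2018]
* M. P. Coiculescu, S. Palasek, Invent. Math. 244 (2025), Prop. 4.1 (the term `ℛ div 𝒩_{k,2}` of `F₄`).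
  [CoiculescuPalasek2025]
-/

noncomputable section

open MeasureTheory Set Filter Function
open _root_.Topology
open scoped BigOperators ContDiff ENNReal NNReal

namespace Literature.Analysis.FluidPDE

namespace CP25

open Literature.Analysis.FunctionSpaces Literature.Analysis.FunctionSpaces.Torus

/-! ## Geometric bounds of order `n + 1` from the partial derivatives at order `n` -/

section Succ

variable {F : Type*} [NormedAddCommGroup F] [NormedSpace ℝ F]

/-- An operator bound by values on the standard basis: `‖T‖ ≤ ∑_l ‖T e_l‖` on `ℝ³`. [folklore] -/
theorem opNorm_le_sum_single (T : EuclideanSpace ℝ (Fin 3) →L[ℝ] F) :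
    ‖T‖ ≤ ∑ l, ‖T (EuclideanSpace.single l (1 : ℝ))‖ := by
  refine ContinuousLinearMap.opNorm_le_bound _ (Finset.sum_nonneg fun l _ => norm_nonneg _) fun v => ?_
  have hv : v = ∑ l, v l • (EuclideanSpace.single l (1 : ℝ) : EuclideanSpace ℝ (Fin 3)) := by
    conv_lhs => rw [← (EuclideanSpace.basisFun (Fin 3) ℝ).sum_repr v]
    simp
  calc ‖T v‖ = ‖∑ l, v l • T (EuclideanSpace.single l (1 : ℝ))‖ := by
        conv_lhs => rw [hv]
        simp [map_sum, map_smul]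
    _ ≤ ∑ l, ‖v l • T (EuclideanSpace.single l (1 : ℝ))‖ := norm_sum_le _ _
    _ ≤ ∑ l, ‖v‖ * ‖T (EuclideanSpace.single l (1 : ℝ))‖ := Finset.sum_le_sum fun l _ => by
        rw [norm_smul]
        exact mul_le_mul_of_nonneg_right (by simpa using PiLp.norm_apply_le v l) (norm_nonneg _)
    _ = (∑ l, ‖T (EuclideanSpace.single l (1 : ℝ))‖) * ‖v‖ := by rw [Finset.sum_mul]; exact Finset.sum_congr rfl fun l _ => mul_comm _ _

/-- **`‖D^{n+1}(lift g)(y)‖ ≤ ∑_l ‖Dⁿ(lift ∂_l g)(y)‖`** for smooth `g` on `T³`. [folklore] -/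
theorem norm_iteratedFDeriv_succ_le_sum_partialDeriv {g : UnitAddTorus (Fin 3) → F} (hg : IsSmooth g) (n : ℕ)
    (y : EuclideanSpace ℝ (Fin 3)) :
    ‖iteratedFDeriv ℝ (n + 1) (lift g) y‖ ≤ ∑ l, ‖iteratedFDeriv ℝ n (lift (Torus.partialDeriv l g)) y‖ := by
  have h1 : IsContDiff 1 g := hg.isContDiff (by simp)
  have hD : ContDiff ℝ ∞ (_root_.fderiv ℝ (lift g)) := hg.fderiv_right (by exact_mod_cast le_top)
  rw [← norm_iteratedFDeriv_fderiv]
  -- the multilinear map `A = Dⁿ(D(lift g))(y)` with values in `ℝ³ →L F`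
  set A := iteratedFDeriv ℝ n (_root_.fderiv ℝ (lift g)) y with hA
  have hl : ∀ l, lift (Torus.partialDeriv l g) = fun z => _root_.fderiv ℝ (lift g) z (EuclideanSpace.single l (1 : ℝ)) :=
    fun l => lift_lineDeriv h1 _
  have happ : ∀ (l : Fin 3) (m : Fin n → EuclideanSpace ℝ (Fin 3)),
      A m (EuclideanSpace.single l (1 : ℝ)) = iteratedFDeriv ℝ n (lift (Torus.partialDeriv l g)) y m := by
    intro l m
    rw [hl l, show (fun z => _root_.fderiv ℝ (lift g) z (EuclideanSpace.single l (1 : ℝ))) =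
        (ContinuousLinearMap.apply ℝ F (EuclideanSpace.single l (1 : ℝ))) ∘ _root_.fderiv ℝ (lift g) from rfl,
      ContinuousLinearMap.iteratedFDeriv_comp_left _ hD.contDiffAt (by exact_mod_cast le_top)]
    rfl
  refine ContinuousMultilinearMap.opNorm_le_bound (Finset.sum_nonneg fun l _ => norm_nonneg _) fun m => ?_
  calc ‖A m‖ ≤ ∑ l, ‖A m (EuclideanSpace.single l (1 : ℝ))‖ := opNorm_le_sum_single _
    _ = ∑ l, ‖iteratedFDeriv ℝ n (lift (Torus.partialDeriv l g)) y m‖ := Finset.sum_congr rfl fun l _ => by rw [happ]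
    _ ≤ ∑ l, ‖iteratedFDeriv ℝ n (lift (Torus.partialDeriv l g)) y‖ * ∏ i, ‖m i‖ :=
        Finset.sum_le_sum fun l _ => ContinuousMultilinearMap.le_opNorm _ _
    _ = (∑ l, ‖iteratedFDeriv ℝ n (lift (Torus.partialDeriv l g)) y‖) * ∏ i, ‖m i‖ := by rw [Finset.sum_mul]

/-- **Order `n+1` from the partial derivatives**: if `‖g‖_∞ ≤ C` and `HasLiftDerivBounds n (∂_l g) (C L) L` for
`l = 0, 1, 2` then `HasLiftDerivBounds (n+1) g (3C) L`. [folklore] -/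
theorem hasLiftDerivBounds_succ_of_partialDeriv {g : UnitAddTorus (Fin 3) → F} (hg : IsSmooth g) {n : ℕ} {C L : ℝ}
    (h0 : ∀ x, ‖g x‖ ≤ C) (h : ∀ l, HasLiftDerivBounds n (Torus.partialDeriv l g) (C * L) L) :
    HasLiftDerivBounds (n + 1) g (3 * C) L := by
  have hC : 0 ≤ C := (norm_nonneg _).trans (h0 0)
  refine ⟨hg, fun i hi y => ?_⟩
  rcases Nat.eq_zero_or_pos i with rfl | hpos
  · rw [norm_iteratedFDeriv_zero, lift_apply, pow_zero, mul_one]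
    exact (h0 _).trans (by linarith)
  · obtain ⟨i, rfl⟩ := Nat.exists_eq_succ_of_ne_zero hpos.ne'
    have hi' : i ≤ n := by omega
    refine (norm_iteratedFDeriv_succ_le_sum_partialDeriv hg i y).trans ?_
    calc ∑ l, ‖iteratedFDeriv ℝ i (lift (Torus.partialDeriv l g)) y‖ ≤ ∑ _l : Fin 3, C * L * L ^ i :=
          Finset.sum_le_sum fun l _ => (h l).bound hi' y
      _ = 3 * C * L ^ (i + 1) := by
          simp only [Finset.sum_const, Finset.card_univ, Fintype.card_fin, nsmul_eq_mul]; push_cast; ring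

end Succ

/-! ## `ℛ div` commutes with partial derivatives -/

section Commute

variable {A : UnitAddTorus (Fin 3) → (Fin 3 → Fin 3 → ℝ)}

/-- The entrywise partial derivative of a tensor field. [folklore] -/
def tensorPartialDeriv (m : Fin 3) (A : UnitAddTorus (Fin 3) → (Fin 3 → Fin 3 → ℝ)) (y : UnitAddTorus (Fin 3)) (a b : Fin 3) : ℝ :=
  Torus.partialDeriv m (fun z => A z a b) y

/-- Entrywise partial derivatives of smooth tensors are smooth. [folklore] -/
theorem isSmooth_tensorPartialDeriv (hA : IsSmooth A) (m : Fin 3) : IsSmooth (tensorPartialDeriv m A) :=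
  isSmooth_of_entries fun a b => (isSmooth_entry hA a b).partialDeriv m

/-- `div (∂_m A) = ∂_m (div A)`. [folklore] -/
theorem tensorDiv_tensorPartialDeriv (hA : IsSmooth A) (m : Fin 3) (x : UnitAddTorus (Fin 3)) :
    tensorDiv (tensorPartialDeriv m A) x = Torus.partialDeriv m (tensorDiv A) x := by
  have hE := isSmooth_entry hA
  have hdiv1 : IsContDiff 1 (tensorDiv A) := (isSmooth_tensorDiv hA).isContDiff (by simp)
  ext i
  rw [tensorDiv_apply, ← partialDeriv_apply_coord hdiv1 m x i,
    show (fun y => tensorDiv A y i) = fun y => ∑ b ∈ Finset.univ, Torus.partialDeriv b (fun z => A z i b) y from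
      funext fun y => by rw [tensorDiv_apply],
    partialDeriv_finset_sum _ (fun b _ => ((hE i b).partialDeriv b).isContDiff (by simp))]
  refine Finset.sum_congr rfl fun b _ => ?_
  unfold tensorPartialDeriv
  exact partialDeriv_comm (hE i b) b m x

variable {u : UnitAddTorus (Fin 3) → EuclideanSpace ℝ (Fin 3)}

set_option maxHeartbeats 1600000 in
/-- `ℛ` commutes with partial derivatives, entrywise: `(ℛ(∂_m u))_{ab} = ∂_m (ℛu)_{ab}`. [folklore] -/
theorem antidivTensor_partialDeriv (hu : IsSmooth u) (m : Fin 3) (x : UnitAddTorus (Fin 3)) (a b : Fin 3) :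
    antidivTensor (Torus.partialDeriv m u) x a b = Torus.partialDeriv m (fun y => antidivTensor u y a b) x := by
  have hum : IsSmooth (Torus.partialDeriv m u) := hu.partialDeriv m
  -- potentials, divergence and `φ` of `∂_m u` are `∂_m` of those of `u`
  have hpot : ∀ j, Torus.antidivPotential (Torus.partialDeriv m u) j = Torus.partialDeriv m (Torus.antidivPotential u j) :=
    fun j => Torus.antidivPotential_partialDeriv hu m j
  have hP : ∀ j, IsSmooth (Torus.antidivPotential u j) := fun j => Torus.isSmooth_antidivPotential hu j
  have hDiv : Torus.antidivDiv (Torus.partialDeriv m u) = Torus.partialDeriv m (Torus.antidivDiv u) := by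
    funext y
    simp only [Torus.antidivDiv, hpot]
    rw [show (Torus.antidivDiv u) = fun y => ∑ l ∈ Finset.univ, Torus.partialDeriv l (Torus.antidivPotential u l) y from rfl,
      partialDeriv_finset_sum _ (fun l _ => ((hP l).partialDeriv l).isContDiff (by simp))]
    exact Finset.sum_congr rfl fun l _ => partialDeriv_comm (hP l) l m y
  have hDs : IsSmooth (Torus.antidivDiv u) := Torus.isSmooth_antidivDiv hu
  have hPhi : Torus.antidivPhi (Torus.partialDeriv m u) = Torus.partialDeriv m (Torus.antidivPhi u) := by
    funext y
    rw [Torus.antidivPhi, Torus.antidivPhi, hDiv, partialDeriv_invLaplacian hDs m y]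
  have hΦ : IsSmooth (Torus.antidivPhi u) := Torus.isSmooth_antidivPhi hu
  -- compare with `partialDeriv_antidivEntry`
  have hL : antidivTensor (Torus.partialDeriv m u) x a b =
      Torus.partialDeriv a (Torus.partialDeriv m (Torus.antidivPotential u b)) x +
        Torus.partialDeriv b (Torus.partialDeriv m (Torus.antidivPotential u a)) x -
      (1 / ((Fintype.card (Fin 3) : ℝ) - 1)) * (if a = b then Torus.partialDeriv m (Torus.antidivDiv u) x else 0) +
      ((2 - (Fintype.card (Fin 3) : ℝ)) / ((Fintype.card (Fin 3) : ℝ) - 1)) *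
        Torus.partialDeriv a (Torus.partialDeriv b (Torus.partialDeriv m (Torus.antidivPhi u))) x := by
    show Torus.antidivEntry (Torus.partialDeriv m u) a b x = _
    rw [Torus.antidivEntry, hpot, hpot, hDiv, hPhi]
  have hR : Torus.partialDeriv m (fun y => antidivTensor u y a b) x =
      Torus.partialDeriv m (Torus.partialDeriv a (Torus.antidivPotential u b)) x +
        Torus.partialDeriv m (Torus.partialDeriv b (Torus.antidivPotential u a)) x -
      (1 / ((Fintype.card (Fin 3) : ℝ) - 1)) * (if a = b then Torus.partialDeriv m (Torus.antidivDiv u) x else 0) +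
      ((2 - (Fintype.card (Fin 3) : ℝ)) / ((Fintype.card (Fin 3) : ℝ) - 1)) *
        Torus.partialDeriv m (Torus.partialDeriv a (Torus.partialDeriv b (Torus.antidivPhi u))) x := by
    show Torus.partialDeriv m (Torus.antidivEntry u a b) x = _
    exact Torus.partialDeriv_antidivEntry hu a b m x
  rw [hL, hR, partialDeriv_comm (hP b) a m x, partialDeriv_comm (hP a) b m x]
  congr 1
  have e1 : Torus.partialDeriv b (Torus.partialDeriv m (Torus.antidivPhi u)) = Torus.partialDeriv m (Torus.partialDeriv b (Torus.antidivPhi u)) :=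
    funext fun y => partialDeriv_comm hΦ b m y
  rw [e1, partialDeriv_comm (hΦ.partialDeriv b) a m x]

/-- **`ℛ(div ∂_m A) = ∂_m ℛ(div A)`** entrywise. [folklore] -/
theorem antidivTensor_tensorDiv_partialDeriv (hA : IsSmooth A) (m : Fin 3) (x : UnitAddTorus (Fin 3)) (a b : Fin 3) :
    antidivTensor (tensorDiv (tensorPartialDeriv m A)) x a b =
      Torus.partialDeriv m (fun y => antidivTensor (tensorDiv A) y a b) x := by
  rw [show tensorDiv (tensorPartialDeriv m A) = Torus.partialDeriv m (tensorDiv A) from funext (tensorDiv_tensorPartialDeriv hA m),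
    antidivTensor_partialDeriv (isSmooth_tensorDiv hA) m x a b]

end Commute

/-! ## The all-orders bound for `ℛ div` -/

section Bounds

variable {A : UnitAddTorus (Fin 3) → (Fin 3 → Fin 3 → ℝ)}

/-- Partial derivatives commute with continuous linear maps. [folklore] -/
theorem partialDeriv_clm_apply {F G : Type*} [NormedAddCommGroup F] [NormedSpace ℝ F] [NormedAddCommGroup G] [NormedSpace ℝ G]
    {f : UnitAddTorus (Fin 3) → F} (hf : IsContDiff 1 f) (φ : F →L[ℝ] G) (l : Fin 3) (x : UnitAddTorus (Fin 3)) :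
    Torus.partialDeriv l (fun y => φ (f y)) x = φ (Torus.partialDeriv l f x) := by
  have hφf : IsContDiff 1 (fun y => φ (f y)) := φ.contDiff.comp hf
  rw [partialDeriv_eq_fderiv_apply hφf, partialDeriv_eq_fderiv_apply hf, Torus.fderiv, Torus.fderiv]
  have hd : DifferentiableAt ℝ (liftAt f x) 0 := ((hf.liftAt x).differentiable one_ne_zero).differentiableAt
  rw [show liftAt (fun y => φ (f y)) x = φ ∘ liftAt f x from rfl, (φ.hasFDerivAt.comp (0 : EuclideanSpace ℝ (Fin 3)) hd.hasFDerivAt).fderiv]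
  rfl

/-- Partial derivatives of a tensor field act entrywise. [folklore] -/
theorem partialDeriv_tensor_apply (hA : IsSmooth A) (l : Fin 3) (x : UnitAddTorus (Fin 3)) (a b : Fin 3) :
    Torus.partialDeriv l A x a b = tensorPartialDeriv l A x a b := by
  set ev : (Fin 3 → Fin 3 → ℝ) →L[ℝ] ℝ :=
    (ContinuousLinearMap.proj (R := ℝ) (φ := fun _ : Fin 3 => ℝ) b).comp
      (ContinuousLinearMap.proj (R := ℝ) (φ := fun _ : Fin 3 => Fin 3 → ℝ) a) with hev
  have h := partialDeriv_clm_apply (hA.isContDiff (by simp)) ev l x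
  simpa [hev, tensorPartialDeriv] using h.symm

/-- Entrywise partial derivatives in the currency. [folklore] -/
theorem hasLiftDerivBounds_tensorPartialDeriv {n : ℕ} {C L : ℝ} (hA : HasLiftDerivBounds (n + 1) A C L) (hL : 0 ≤ L) (m : Fin 3) :
    HasLiftDerivBounds n (tensorPartialDeriv m A) (C * L) L := by
  refine HasLiftDerivBounds.of_pi (fun a => HasLiftDerivBounds.of_pi (fun b => ?_) (by have := hA.nonneg; positivity) hL)
    (by have := hA.nonneg; positivity) hL
  exact ((hA.pi_apply a).pi_apply b).partialDeriv m

/-- The column form `x ↦ (j ↦ (i ↦ A_{ij}))` of a real tensor (the convention of `Torus.tensorDivergence`). [folklore] -/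
def colForm (A : UnitAddTorus (Fin 3) → (Fin 3 → Fin 3 → ℝ)) (x : UnitAddTorus (Fin 3)) (j : Fin 3) : EuclideanSpace ℝ (Fin 3) :=
  WithLp.toLp 2 fun i => A x i j

/-- The column-form map as a continuous linear map of norm `≤ 2`. [folklore] -/
def colFormCLM : (Fin 3 → Fin 3 → ℝ) →L[ℝ] (Fin 3 → EuclideanSpace ℝ (Fin 3)) :=
  LinearMap.mkContinuous
    { toFun := fun G j => WithLp.toLp 2 fun i => G i j
      map_add' := fun G H => by funext j; ext i; simp
      map_smul' := fun c G => by funext j; ext i; simp }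
    2 (fun G => by
      refine (pi_norm_le_iff_of_nonneg (by positivity)).2 fun j => ?_
      change ‖(WithLp.toLp 2 fun i => G i j : EuclideanSpace ℝ (Fin 3))‖ ≤ 2 * ‖G‖
      have hG : ∀ i, |G i j| ≤ ‖G‖ := fun i => by
        calc |G i j| = ‖G i j‖ := (Real.norm_eq_abs _).symm
          _ ≤ ‖G i‖ := norm_le_pi_norm (G i) j
          _ ≤ ‖G‖ := norm_le_pi_norm G i
      have h0 : 0 ≤ ‖G‖ := norm_nonneg _
      rw [EuclideanSpace.norm_eq]
      have hsum : ∑ i : Fin 3, ‖(WithLp.toLp 2 fun i => G i j : EuclideanSpace ℝ (Fin 3)) i‖ ^ 2 ≤ 3 * ‖G‖ ^ 2 := by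
        calc ∑ i : Fin 3, ‖(WithLp.toLp 2 fun i => G i j : EuclideanSpace ℝ (Fin 3)) i‖ ^ 2 ≤ ∑ _i : Fin 3, ‖G‖ ^ 2 :=
              Finset.sum_le_sum fun i _ => by
                rw [PiLp.toLp_apply, Real.norm_eq_abs]; exact pow_le_pow_left₀ (abs_nonneg _) (hG i) 2
          _ = 3 * ‖G‖ ^ 2 := by simp
      calc Real.sqrt (∑ i : Fin 3, ‖(WithLp.toLp 2 fun i => G i j : EuclideanSpace ℝ (Fin 3)) i‖ ^ 2)
          ≤ Real.sqrt (3 * ‖G‖ ^ 2) := Real.sqrt_le_sqrt hsum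
        _ ≤ Real.sqrt ((2 * ‖G‖) ^ 2) := Real.sqrt_le_sqrt (by nlinarith)
        _ = 2 * ‖G‖ := Real.sqrt_sq (by positivity))

/-- `colForm A x = colFormCLM (A x)`. [folklore] -/
theorem colForm_eq (A : UnitAddTorus (Fin 3) → (Fin 3 → Fin 3 → ℝ)) : colForm A = fun x => colFormCLM (A x) := rfl

/-- `‖colFormCLM‖ ≤ 2`. [folklore] -/
theorem norm_colFormCLM_le : ‖colFormCLM‖ ≤ 2 := LinearMap.mkContinuous_norm_le _ (by norm_num) _

/-- The column form is smooth. [folklore] -/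
theorem isSmooth_colForm (hA : IsSmooth A) : IsSmooth (colForm A) := by
  rw [colForm_eq]; exact hA.comp_clm colFormCLM

/-- The column form in the currency (factor `2`). [folklore] -/
theorem hasLiftDerivBounds_colForm {n : ℕ} {C L : ℝ} (hA : HasLiftDerivBounds n A C L) (hL : 0 ≤ L) :
    HasLiftDerivBounds n (colForm A) (2 * C) L := by
  have h := hA.clm_comp colFormCLM
  rw [colForm_eq]
  refine h.mono ?_ hL le_rfl
  exact mul_le_mul_of_nonneg_right norm_colFormCLM_le hA.nonneg

/-- `div (colForm A) = div A` (column vs. row conventions). [folklore] -/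
theorem tensorDivergence_colForm (hA : IsSmooth A) : Torus.tensorDivergence (colForm A) = tensorDiv A := by
  funext x
  ext i
  rw [tensorDiv_apply, Torus.tensorDivergence, WithLp.ofLp_sum, Finset.sum_apply]
  refine Finset.sum_congr rfl fun j _ => ?_
  have hcol : IsContDiff 1 (fun y => colForm A y j) := ((isSmooth_colForm hA).column j).isContDiff (by simp)
  rw [← partialDeriv_apply_coord hcol j x i]
  rfl

/-- `ℛ div A` through the column form. [folklore] -/
theorem antidivTensor_tensorDiv_eq (hA : IsSmooth A) (x : UnitAddTorus (Fin 3)) (a b : Fin 3) :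
    antidivTensor (tensorDiv A) x a b = Torus.antidivergence (Torus.tensorDivergence (colForm A)) x b a := by
  rw [tensorDivergence_colForm hA, Torus.antidivergence_apply]; rfl

variable {α : ℝ≥0}

/-- The `C^{0,α}` constant of `ℛ div` (choice from `BDSV.holder_antidivergence_tensorDivergence_le`). [cite: BuckmasterEtAl2018, App. C Prop. C.1] -/
def czDivConst0 (α : ℝ≥0) (hα : 0 < α) (hα1 : α < 1) : ℝ≥0 :=
  Classical.choose (BDSV.holder_antidivergence_tensorDivergence_le BDSV.holderCZBound_holds hα hα1)

/-- The defining property of `czDivConst0`. [cite: BuckmasterEtAl2018, App. C Prop. C.1] -/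
theorem czDivConst0_spec (hα : 0 < α) (hα1 : α < 1) (B : UnitAddTorus (Fin 3) → Fin 3 → EuclideanSpace ℝ (Fin 3)) (hB : IsSmooth B) :
    Torus.eContDiffHolderNorm 0 α (Torus.antidivergence (Torus.tensorDivergence B)) ≤
      czDivConst0 α hα hα1 * Torus.eContDiffHolderNorm 0 α B :=
  Classical.choose_spec (BDSV.holder_antidivergence_tensorDivergence_le BDSV.holderCZBound_holds hα hα1) B hB

/-- **The all-orders constants of `ℛ div`**: `K₀ = 8 C_α`, `K_{n+1} = 3 K_n`. [cite: BuckmasterEtAl2018, App. C Prop. C.1] -/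
def czDivConst (α : ℝ≥0) (hα : 0 < α) (hα1 : α < 1) : ℕ → ℝ
  | 0 => 8 * czDivConst0 α hα hα1
  | n + 1 => 3 * czDivConst α hα hα1 n

/-- `0 ≤ K_n`. [folklore] -/
theorem czDivConst_nonneg (hα : 0 < α) (hα1 : α < 1) : ∀ n, 0 ≤ czDivConst α hα hα1 n
  | 0 => by simp [czDivConst]
  | n + 1 => by have := czDivConst_nonneg hα hα1 n; simp [czDivConst]; positivity

/-- **The base case**: `HasLiftDerivBounds 1 A C L`, `1 ≤ L` ⟹ `HasLiftDerivBounds 0 (ℛ div A) (8 C_α C L^α) L`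
(the `C^{0,α}` bound read in sup norm). [cite: BuckmasterEtAl2018, App. C Prop. C.1] -/
theorem hasLiftDerivBounds_antidivTensor_tensorDiv_zero (hα : 0 < α) (hα1 : α < 1) {C L : ℝ}
    (hA : HasLiftDerivBounds 1 A C L) (hL : 1 ≤ L) :
    HasLiftDerivBounds 0 (antidivTensor (tensorDiv A)) (czDivConst α hα hα1 0 * C * L ^ (α : ℝ)) L := by
  have hL0 : 0 ≤ L := le_trans zero_le_one hL
  have hC := hA.nonneg
  have hAs := hA.isSmooth
  have hcol := hasLiftDerivBounds_colForm hA hL0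
  have hcs := isSmooth_colForm hAs
  -- `‖colForm A‖_{C^{0,α}} ≤ 4 · 2C · L^α`
  have hH := eContDiffHolderNorm_le_of_hasLiftDerivBounds (N := 0) hcol hL hα1.le
  have hR := czDivConst0_spec hα hα1 (colForm A) hcs
  have hK0 : 0 ≤ (czDivConst0 α hα hα1 : ℝ) := NNReal.coe_nonneg _
  have hB0 : 0 ≤ ((0 : ℕ) : ℝ) + 4 := by norm_num
  have hbound : Torus.eContDiffHolderNorm 0 α (Torus.antidivergence (Torus.tensorDivergence (colForm A))) ≤
      ENNReal.ofReal (czDivConst0 α hα hα1 * ((((0 : ℕ) : ℝ) + 4) * (2 * C) * L ^ (0 : ℕ) * L ^ (α : ℝ))) := by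
    refine hR.trans ?_
    rw [ENNReal.ofReal_mul hK0, ENNReal.ofReal_coe_nnreal]
    exact mul_le_mul' le_rfl hH
  have hsmR : IsSmooth (antidivTensor (tensorDiv A)) := isSmooth_antidivTensor (isSmooth_tensorDiv hAs)
  refine ⟨hsmR, fun i hi y => ?_⟩
  have hi0 : i = 0 := Nat.le_zero.1 hi
  subst hi0
  rw [norm_iteratedFDeriv_zero, lift_apply, pow_zero, mul_one]
  -- entry ≤ norm of the whole antidivergence
  have h1 := norm_iteratedFDeriv_lift_le_of_eContDiffHolderNorm_le (N := 0) (i := 0) (by positivity) hbound le_rfl y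
  rw [norm_iteratedFDeriv_zero, lift_apply] at h1
  have hentry : ‖antidivTensor (tensorDiv A) (proj y)‖ ≤ ‖Torus.antidivergence (Torus.tensorDivergence (colForm A)) (proj y)‖ := by
    refine (pi_norm_le_iff_of_nonneg (norm_nonneg _)).2 fun a => (pi_norm_le_iff_of_nonneg (norm_nonneg _)).2 fun b => ?_
    rw [antidivTensor_tensorDiv_eq hAs]
    exact (PiLp.norm_apply_le _ a).trans (norm_le_pi_norm _ b)
  refine hentry.trans (h1.trans (le_of_eq ?_))
  rw [show czDivConst α hα hα1 0 = 8 * czDivConst0 α hα hα1 from rfl]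
  push_cast; ring

/-- **All orders**: `HasLiftDerivBounds (n+1) A C L`, `1 ≤ L` ⟹ `HasLiftDerivBounds n (ℛ div A) (K_n C L^α) L`.
[cite: BuckmasterEtAl2018, App. C Prop. C.1] -/
theorem hasLiftDerivBounds_antidivTensor_tensorDiv (hα : 0 < α) (hα1 : α < 1) :
    ∀ (n : ℕ) {A : UnitAddTorus (Fin 3) → (Fin 3 → Fin 3 → ℝ)} {C L : ℝ}, HasLiftDerivBounds (n + 1) A C L → 1 ≤ L →
      HasLiftDerivBounds n (antidivTensor (tensorDiv A)) (czDivConst α hα hα1 n * C * L ^ (α : ℝ)) L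
  | 0, A, C, L, hA, hL => hasLiftDerivBounds_antidivTensor_tensorDiv_zero hα hα1 hA hL
  | n + 1, A, C, L, hA, hL => by
    have hL0 : 0 ≤ L := le_trans zero_le_one hL
    have hAs := hA.isSmooth
    have hsmR : IsSmooth (antidivTensor (tensorDiv A)) := isSmooth_antidivTensor (isSmooth_tensorDiv hAs)
    -- the sup bound from the previous order
    have hprev := hasLiftDerivBounds_antidivTensor_tensorDiv hα hα1 n (hA.of_le (by omega)) hL
    -- the partial derivatives
    have hpd : ∀ m, HasLiftDerivBounds n (Torus.partialDeriv m (antidivTensor (tensorDiv A)))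
        (czDivConst α hα hα1 n * C * L ^ (α : ℝ) * L) L := by
      intro m
      have hAm := hasLiftDerivBounds_tensorPartialDeriv hA hL0 m
      have h := hasLiftDerivBounds_antidivTensor_tensorDiv hα hα1 n hAm hL
      have hfun : antidivTensor (tensorDiv (tensorPartialDeriv m A)) = Torus.partialDeriv m (antidivTensor (tensorDiv A)) := by
        funext y a b
        rw [antidivTensor_tensorDiv_partialDeriv hAs m y a b, partialDeriv_tensor_apply hsmR m y a b]
        rfl
      rw [hfun] at h
      refine h.mono (le_of_eq (by ring)) hL0 le_rfl
    have h0 : ∀ x, ‖antidivTensor (tensorDiv A) x‖ ≤ czDivConst α hα hα1 n * C * L ^ (α : ℝ) := hprev.norm_le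
    have hs := hasLiftDerivBounds_succ_of_partialDeriv hsmR h0 hpd
    refine ⟨hs.isSmooth, fun i hi y => (hs.bound hi y).trans (le_of_eq ?_)⟩
    rw [show czDivConst α hα hα1 (n + 1) = 3 * czDivConst α hα hα1 n from rfl]
    ring

end Bounds

end CP25

end Literature.Analysis.FluidPDE
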